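import Summits.ResolutionOfSingularities.ResolutionOfSingularities.Theorems.EquisingularLiftEquisingularLiftNatModelStep
import Summits.ResolutionOfSingularities.ResolutionOfSingularities.Theorems.EquisingularLiftEquisingularLiftNatModelChainStep
import Literature.AlgebraicGeometry.Resolution.BlowupSequencesExtensions
import HarnessLib

/-!
# [OURS · L1 W4.5(b) · EL♮(3) · WIDTH TABLE D18 «DESCENT-CERTIFICATE DOOR», engine brick (E4)] THE TRANSFORM CHAIN THROUGH THE MODEL SQUARES
# — one stage of a descended tower: the k-side position tokens become the O-side step hypotheses of `ELNatConclusionO`, the model square and the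
# strict-transform SET are carried to the next stage, and the comparison map is the CANONICAL one (so the next centres again match); plus the END transfer

res-L1-w45b-stub-4 g16 (STUB WORKER 4; desk ★★ R88-PRE of 2026-08-29 «stub-4 g16: (E4) transform-chain-through-pullback-squares brick», pens at own risk
before the deal; sizing res-L1-w45b-idea-2 g32 `D18-LETTERS-idea2.md` v1.2 §2 (E4)/(E5)).  Crux EL♮(3) = stmt-ResolutionOfSingularities-20148 (parent EL♮
stmt-…-20038; bookkeeping crux stmt-…-15660).  OURS; NOT a statement of any manuscript ([Hironaka2017] is a candidate under adjudication, nothing of it is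
asserted); AI-written, weaker than expert review.  DEF-FREE; no `sorry`; standard axioms; `--supports stmt-…-20148 --as helper`, counted 0.

WHAT (the per-stage content of (E4); the recursion over 027's `TransformOK` / `CentresSmoothOver` — DefsE10, not yet typed — calls these once per centre).
In the D18 engine `descDoor_elnat` the O-tower `s_O = s.comap ι_O` and the k-tower `s_k = s.comap ι_k` of a B-tower `s : CentreSeq ℙⁿ_B` are compared stage by
stage through MODEL SQUARES `j : X_k ⟶ X_O` over `Spec θ : Spec k ⟶ Spec O` with `j ≫ ι_O = ι_k`; the k-side door gives the position tokens of the
running transform `T ⊆ X_k`, the O-side conclusion `ELNatConclusionO` wants them for `S' = j '' T ⊆ X_O`.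
* `Descent.image_support_subset_of_model` / `…_of_model'` — position token (iv) «the O-centre lies off the generic point of `Y`» FROM the k-side, in two
  currencies: the chain form «`D = C·𝒪_{X_k}` off the generic point(s) of the running k-transform `T`» (via ✓ `Chain.fibre`), and res-type-027's
  `DescTransformOK` form (DefsE10 rev2) «`σ_k '' supp D` off the generic point of `Y₀ ⊆ ℙⁿ_k`» through the special-fibre immersion `j₀` of the base
  (`j ≫ σ' = σ_k ≫ j₀`, `Y = j₀ '' Y₀`; no chain hypothesis).
* ★ `Descent.modelStage` / `Descent.modelStage'` — ONE DESCENDED STAGE (two currencies of token (iv)): res-L1-w45b-stub-4 / res-D-pv-029's ✓ `modelStep` (…NatModelStep) with token (iv) DERIVED and token (v)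
  «`V(C) ∩` special fibre `⊆ S'`» inside: inputs = the stage `(X', σ', S')` with `Ch`, the model square `(j, t)`, `j '' T = S'`, the O-centre `C`
  (regular, O-flat: (E3)) and the k-centre `D` with `C·𝒪_{X_k} = D`, the k-tokens `supp D ⊆ T`, `∀ x ∈ supp D, ¬ IsGenericPoint x T`, the two
  blow-ups; outputs = `Ch` at the new stage, regular, locally Noetherian, the NEW model square `j₂` with `j₂ ≫ τ = υ ≫ j` and
  `j₂ '' closure (υ⁻¹(T ∖ supp D)) = closure (τ⁻¹(S' ∖ supp C))` — i.e. idea-2's `TransformOK` E1-clause at this stage ⇒ the `ELNatConclusionO` step.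
* `Descent.comp_comapMap_eq` — the comparison map of `modelStage` between the CHOSEN blow-ups `Bl_{C·𝒪_{X_k}} X_k ⟶ Bl_{C·𝒪_{X_O}} X_O` composed with
  `Bl(ι_O)` IS `Bl(ι_k)` (Literature ✓ `blowup.hom_ext_over`); hence `Descent.comap_comapMap_comp_eq`: the NEXT B-centre again satisfies
  `(C'.comap ι_O').comap j₂ = C'.comap ι_k'` — the recursion along `CentreSeq.comap` closes.
* `Descent.isRegular_reducedTransform_of_model` — (E5) END: `IsRegular (𝓘⟨closure T⟩).subscheme ⇒ IsRegular (𝓘⟨closure S'⟩).subscheme` for `S' = j '' T`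
  (✓ `isRegular_subscheme_vanishingIdeal_image_iff`, …StrictTransformSpecialFibreTransport).
[cite: StacksProject, Tags 0805, 056P, 01J3] [cite: Liu2002, Thm. 8.1.19] [cite: GortzWedhorn2020, Prop. 13.91] (method; index only).
-/

set_option linter.dupNamespace false -- mandated namespace `Summit.<Summit>.<Problem>` of this single-conjunct summit

noncomputable section

open CategoryTheory CategoryTheory.Limits AlgebraicGeometry TopologicalSpace Topology
open Literature.AlgebraicGeometry.Resolution
open AlgebraicGeometry.Scheme.IdealSheafData
open Summit.ResolutionOfSingularities.ResolutionOfSingularities.Theses.EquisingularLift.Split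
open Summit.ResolutionOfSingularities.ResolutionOfSingularities.Cruxes.EquisingularLift.StrataSplit

namespace Summit.ResolutionOfSingularities.ResolutionOfSingularities.Cruxes.EquisingularLiftNat.Sections

/-! ## Position token (iv) from the k-side -/

section OffGeneric

variable {O : Type} [CommRing O] [IsLocalRing O] {k : Type} [Field k] (θ : O →+* k) (hθ : Function.Surjective θ)
  {P : Scheme.{0}} (q : P ⟶ Spec (.of O)) {Y : Set P} (hYsp : Y ⊆ q ⁻¹' {IsLocalRing.closedPoint O})

include hθ hYsp

/-- **(E4, token (iv)) the O-centre lies off the generic point of `Y`, from the k-side.**  At a chain stage `(X', σ', S')` over `Y` with model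
square `j : F ⟶ X'` over `Spec θ` and `j '' T = S'`, an ideal sheaf `C` on `X'` whose restriction `D = C·𝒪_F` to the special fibre has support OFF
THE GENERIC POINT(S) OF `T` is supported off the generic point of `Y` after `σ'`: a point of `V(C)` over the generic point of `Spec O` maps outside the
special fibre `⊇ Y`; a point of `V(C)` in the special fibre is `j y` with `y ∈ supp D`, and were `σ' (j y)` generic in `Y`, the chain's fibre clause
(✓ `Chain.fibre`: `σ'⁻¹{η_Y} = {ξ'}`, `S' = closure {ξ'}`) would make `j y` generic in `S' = j '' T`, i.e. `y` generic in `T`.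
[folklore over the route's `Chain.fibre`] [OURS · L1 W4.5b · D18 engine (E4)] -/
theorem Descent.image_support_subset_of_model {X' F : Scheme.{0}} (σ' : X' ⟶ P) (S' : Set X') (hch : Chain P Y X' σ' S')
    (j : F ⟶ X') (t : F ⟶ Spec (.of k)) (hsq : IsPullback j t (σ' ≫ q) (Spec.map (CommRingCat.ofHom θ)))
    (T : Set F) (hTS : j '' T = S')
    (C : X'.IdealSheafData) (D : F.IdealSheafData) (hCD : C.comap j = D)
    (hDgen : ∀ x ∈ (D.support : Set F), ¬ IsGenericPoint x T) :
    σ' '' (C.support : Set X') ⊆ {x : P | ¬ IsGenericPoint x Y} := by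
  haveI : IsClosedImmersion (Spec.map (CommRingCat.ofHom θ)) := IsClosedImmersion.spec_of_surjective _ hθ
  haveI hjci : IsClosedImmersion j := MorphismProperty.IsStableUnderBaseChange.of_isPullback hsq.flip inferInstance
  have hrangej : Set.range j = (σ' ≫ q) ⁻¹' {IsLocalRing.closedPoint O} := by
    rw [range_eq_preimage_of_isPullback hsq, range_specMap_of_surjective_of_field θ hθ]
  rintro _ ⟨x, hxC, rfl⟩ hgen
  -- `σ' x ∈ Y` lies in the special fibre, hence so does `x`: `x = j y`
  have hxs : x ∈ (σ' ≫ q) ⁻¹' {IsLocalRing.closedPoint O} := hYsp hgen.mem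
  obtain ⟨y, rfl⟩ : x ∈ Set.range j := by rw [hrangej]; exact hxs
  have hy : y ∈ (D.support : Set F) := by rw [← hCD, support_comap]; exact hxC
  -- the chain's fibre over the generic point of `Y`
  obtain ⟨ξ', hfib, hS⟩ := Chain.fibre hch hgen
  have h1 : j y = ξ' := by
    have h2 : j y ∈ σ' ⁻¹' {σ' (j y)} := rfl
    rw [hfib] at h2
    exact h2
  have h3 : IsGenericPoint (j y) (j '' T) := by rw [hTS, h1, isGenericPoint_def, hS]
  exact hDgen y hy (isGenericPoint_of_isClosedEmbedding hjci.isClosedEmbedding h3)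


omit hθ in
/-- **(E4, token (iv)) — the form of res-type-027's `DescTransformOK` (DefsE10 rev2, idea-2 (A1)): the k-side token is the Fact's own, stated in `ℙⁿ_k`.**
If the model square sits over the closed immersion `j₀ : P_k ⟶ P` of the special fibre of the base (`j ≫ σ' = σ_k ≫ j₀`, `Y = j₀ '' Y₀`) and the k-centre
maps off the generic point of `Y₀` under `σ_k`, then the O-centre maps off the generic point of `Y` under `σ'` (special-fibre points: `σ' (j y) = j₀ (σ_k y)`
and `j₀` is a closed embedding; generic-fibre points do not reach `Y ⊆` special fibre).  No chain hypothesis. [folklore] [OURS · L1 W4.5b · D18 engine (E4)] -/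
theorem Descent.image_support_subset_of_model' {X' F Pk : Scheme.{0}} (σ' : X' ⟶ P)
    (j : F ⟶ X') (t : F ⟶ Spec (.of k)) (hsq : IsPullback j t (σ' ≫ q) (Spec.map (CommRingCat.ofHom θ))) (hθ : Function.Surjective θ)
    (j₀ : Pk ⟶ P) [IsClosedImmersion j₀] (σk : F ⟶ Pk) (hcomm : j ≫ σ' = σk ≫ j₀) (Y₀ : Set Pk) (hY : j₀ '' Y₀ = Y)
    (C : X'.IdealSheafData) (D : F.IdealSheafData) (hCD : C.comap j = D)
    (hDgen : σk '' (D.support : Set F) ⊆ {x : Pk | ¬ IsGenericPoint x Y₀}) :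
    σ' '' (C.support : Set X') ⊆ {x : P | ¬ IsGenericPoint x Y} := by
  haveI : IsClosedImmersion (Spec.map (CommRingCat.ofHom θ)) := IsClosedImmersion.spec_of_surjective _ hθ
  have hrangej : Set.range j = (σ' ≫ q) ⁻¹' {IsLocalRing.closedPoint O} := by
    rw [range_eq_preimage_of_isPullback hsq, range_specMap_of_surjective_of_field θ hθ]
  rintro _ ⟨x, hxC, rfl⟩ hgen
  have hxs : x ∈ (σ' ≫ q) ⁻¹' {IsLocalRing.closedPoint O} := hYsp hgen.mem
  obtain ⟨y, rfl⟩ : x ∈ Set.range j := by rw [hrangej]; exact hxs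
  have hy : y ∈ (D.support : Set F) := by rw [← hCD, support_comap]; exact hxC
  have h1 : σ' (j y) = j₀ (σk y) := by
    rw [← Scheme.Hom.comp_apply, hcomm, Scheme.Hom.comp_apply]
  rw [h1, ← hY] at hgen
  exact hDgen ⟨y, hy, rfl⟩ (isGenericPoint_of_isClosedEmbedding j₀.isClosedEmbedding hgen)

end OffGeneric

/-! ## One descended stage -/

section Stage

variable (O : Type) [CommRing O] [IsLocalRing O] (k : Type) [Field k] (θ : O →+* k) (hθ : Function.Surjective θ)
  (P : Scheme.{0}) (q : P ⟶ Spec (.of O)) (Y : Set P) (hYsp : Y ⊆ q ⁻¹' {IsLocalRing.closedPoint O})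
  (Ch : ∀ X' : Scheme.{0}, (X' ⟶ P) → Set X' → Prop)
  (hChain : ∀ (X' : Scheme.{0}) (σ : X' ⟶ P) (S : Set X'), Ch X' σ S → Chain P Y X' σ S)
  (hStep : ∀ (X' X'' : Scheme.{0}) (σ' : X' ⟶ P) (S' : Set X') (C : X'.IdealSheafData) (τ : X'' ⟶ X'),
    Ch X' σ' S' → IsBlowup τ C → Scheme.IsRegular C.subscheme → Flat (C.subschemeι ≫ σ' ≫ q) →
    σ' '' (C.support : Set X') ⊆ {x : P | ¬ IsGenericPoint x Y} →
    (C.support : Set X') ∩ (σ' ≫ q) ⁻¹' {IsLocalRing.closedPoint O} ⊆ S' →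
    Ch X'' (τ ≫ σ') (closure (τ ⁻¹' (S' \ (C.support : Set X')))))

include hθ hYsp hChain hStep

/-- ★ **(E4) `Descent.modelStage` — ONE STAGE OF A DESCENDED TOWER THROUGH ITS MODEL SQUARE.**  Data: a `Ch`-stage `(X', σ', S')` (regular, locally
Noetherian), its model square `j : F ⟶ X'` over `Spec θ` with the running k-transform `T`, `j '' T = S'`; the O-centre `C` (regular, O-flat — the
descended smooth B-centre, (E3)) and the k-centre `D` with `C·𝒪_F = D`; the k-side POSITION TOKENS of the door (`supp D ⊆ T`, every point of `supp D`
off the generic point(s) of `T`); the blow-ups `τ` (along `C`) and `υ` (along `D`).  Output: `Ch` at `(X'', τ ≫ σ', closure τ⁻¹(S' ∖ supp C))`,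
`X''` regular and locally Noetherian, and the NEXT model square `j₂ : F₂ ⟶ X''` over `Spec θ` with `j₂ ≫ τ = υ ≫ j` and
`j₂ '' closure (υ⁻¹(T ∖ supp D)) = closure (τ⁻¹(S' ∖ supp C))`.  = ✓ `modelStep` with token (iv) supplied by `Descent.image_support_subset_of_model`.
[cite: StacksProject, Tags 0805, 056P] [cite: Liu2002, Thm. 8.1.19] [OURS · L1 W4.5b · D18 engine (E4)]; NOT a statement of the manuscript. -/
theorem Descent.modelStage
    (X' : Scheme.{0}) (σ' : X' ⟶ P) (S' : Set X') (hCh : Ch X' σ' S')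
    [IsLocallyNoetherian X'] (hreg : Scheme.IsRegular X')
    (F : Scheme.{0}) (j : F ⟶ X') (t : F ⟶ Spec (.of k))
    (hsq : IsPullback j t (σ' ≫ q) (Spec.map (CommRingCat.ofHom θ)))
    (T : Set F) (hTS : j '' T = S')
    (C : X'.IdealSheafData) (D : F.IdealSheafData) (hCD : C.comap j = D)
    (hCreg : Scheme.IsRegular C.subscheme) (hCflat : Flat (C.subschemeι ≫ σ' ≫ q))
    (hDT : (D.support : Set F) ⊆ T) (hDgen : ∀ x ∈ (D.support : Set F), ¬ IsGenericPoint x T)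
    (X'' : Scheme.{0}) (τ : X'' ⟶ X') (hτ : IsBlowup τ C)
    (F₂ : Scheme.{0}) (υ : F₂ ⟶ F) (hυ : IsBlowup υ D) :
    Ch X'' (τ ≫ σ') (closure (τ ⁻¹' (S' \ (C.support : Set X')))) ∧
    Scheme.IsRegular X'' ∧ IsLocallyNoetherian X'' ∧
    ∃ (j₂ : F₂ ⟶ X'') (t₂ : F₂ ⟶ Spec (.of k)),
      IsPullback j₂ t₂ ((τ ≫ σ') ≫ q) (Spec.map (CommRingCat.ofHom θ)) ∧ j₂ ≫ τ = υ ≫ j ∧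
      j₂ '' closure (υ ⁻¹' (T \ (D.support : Set F))) = closure (τ ⁻¹' (S' \ (C.support : Set X'))) :=
  modelStep O k θ hθ P q Y Ch hStep X' σ' S' hCh hreg F j t hsq T hTS C D hCD hCreg hCflat
    (Descent.image_support_subset_of_model θ hθ q hYsp σ' S' (hChain _ _ _ hCh) j t hsq T hTS C D hCD hDgen) hDT X'' τ hτ F₂ υ hυ


omit hChain in
/-- ★ **(E4) `Descent.modelStage'` — the same stage with token (iv) in res-type-027's `DescTransformOK` form** (k-side: `σ_k '' supp D` off the generic point of
`Y₀ ⊆ P_k`, the model square over the special-fibre immersion `j₀ : P_k ⟶ P` of the base with `j ≫ σ' = σ_k ≫ j₀`, `Y = j₀ '' Y₀`); no `Ch ⇒ Chain` needed.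
The next stage's commutation `j₂ ≫ (τ ≫ σ') = (υ ≫ σ_k) ≫ j₀` is immediate from `j₂ ≫ τ = υ ≫ j`. [cite: StacksProject, Tags 0805, 056P]
[OURS · L1 W4.5b · D18 engine (E4)]; NOT a statement of the manuscript. -/
theorem Descent.modelStage'
    (X' : Scheme.{0}) (σ' : X' ⟶ P) (S' : Set X') (hCh : Ch X' σ' S')
    [IsLocallyNoetherian X'] (hreg : Scheme.IsRegular X')
    (F : Scheme.{0}) (j : F ⟶ X') (t : F ⟶ Spec (.of k))
    (hsq : IsPullback j t (σ' ≫ q) (Spec.map (CommRingCat.ofHom θ)))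
    (T : Set F) (hTS : j '' T = S')
    {Pk : Scheme.{0}} (j₀ : Pk ⟶ P) [IsClosedImmersion j₀] (σk : F ⟶ Pk) (hcomm : j ≫ σ' = σk ≫ j₀) (Y₀ : Set Pk) (hY : j₀ '' Y₀ = Y)
    (C : X'.IdealSheafData) (D : F.IdealSheafData) (hCD : C.comap j = D)
    (hCreg : Scheme.IsRegular C.subscheme) (hCflat : Flat (C.subschemeι ≫ σ' ≫ q))
    (hDT : (D.support : Set F) ⊆ T) (hDgen : σk '' (D.support : Set F) ⊆ {x : Pk | ¬ IsGenericPoint x Y₀})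
    (X'' : Scheme.{0}) (τ : X'' ⟶ X') (hτ : IsBlowup τ C)
    (F₂ : Scheme.{0}) (υ : F₂ ⟶ F) (hυ : IsBlowup υ D) :
    Ch X'' (τ ≫ σ') (closure (τ ⁻¹' (S' \ (C.support : Set X')))) ∧
    Scheme.IsRegular X'' ∧ IsLocallyNoetherian X'' ∧
    ∃ (j₂ : F₂ ⟶ X'') (t₂ : F₂ ⟶ Spec (.of k)),
      IsPullback j₂ t₂ ((τ ≫ σ') ≫ q) (Spec.map (CommRingCat.ofHom θ)) ∧ j₂ ≫ τ = υ ≫ j ∧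
      j₂ '' closure (υ ⁻¹' (T \ (D.support : Set F))) = closure (τ ⁻¹' (S' \ (C.support : Set X'))) ∧
      j₂ ≫ (τ ≫ σ') = (υ ≫ σk) ≫ j₀ := by
  obtain ⟨h1, h2, h3, j₂, t₂, hsq₂, hcomm₂, hsets⟩ :=
    modelStep O k θ hθ P q Y Ch hStep X' σ' S' hCh hreg F j t hsq T hTS C D hCD hCreg hCflat
      (Descent.image_support_subset_of_model' θ q hYsp σ' j t hsq hθ j₀ σk hcomm Y₀ hY C D hCD hDgen) hDT X'' τ hτ F₂ υ hυ
  refine ⟨h1, h2, h3, j₂, t₂, hsq₂, hcomm₂, hsets, ?_⟩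
  rw [← Category.assoc, hcomm₂, Category.assoc, hcomm, Category.assoc]

end Stage

/-! ## The comparison map is the canonical one: the recursion along `CentreSeq.comap` closes -/

section Canonical

variable {XB XO Xk : Scheme.{0}} (ιO : XO ⟶ XB) (ιk : Xk ⟶ XB) (j : Xk ⟶ XO) (hj : j ≫ ιO = ιk) (CB : XB.IdealSheafData)

include hj

/-- The descended centres match: `(C_B·𝒪_{X_O})·𝒪_{X_k} = C_B·𝒪_{X_k}` along `j ≫ ι_O = ι_k`. [folklore] -/
theorem Descent.comap_comap_eq : (CB.comap ιO).comap j = CB.comap ιk := by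
  rw [← Scheme.IdealSheafData.comap_comp, hj]

/-- **The comparison map of `Descent.modelStage` between the CHOSEN blow-ups is `Bl(ι_k)` after `Bl(ι_O)`**: any `j₂ : Bl_{C_B·𝒪_{X_k}} X_k ⟶ Bl_{C_B·𝒪_{X_O}} X_O`
with `j₂ ≫ π_O = π_k ≫ j` satisfies `j₂ ≫ Bl(ι_O) = Bl(ι_k)` (uniqueness of morphisms of blow-ups over `ι_k`, Literature ✓ `blowup.hom_ext_over`).
[folklore] [OURS · L1 W4.5b · D18 engine (E4)] -/
theorem Descent.comp_comapMap_eq (j₂ : blowup (CB.comap ιk) ⟶ blowup (CB.comap ιO))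
    (hj₂ : j₂ ≫ blowup.π (CB.comap ιO) = blowup.π (CB.comap ιk) ≫ j) :
    j₂ ≫ blowup.comapMap CB ιO = blowup.comapMap CB ιk := by
  refine blowup.hom_ext_over (C := CB) (C' := CB.comap ιk) (f := ιk) rfl ?_ (blowup.comapMap_π CB ιk)
  rw [Category.assoc, blowup.comapMap_π, ← Category.assoc, hj₂, Category.assoc, hj]

/-- **Hence the NEXT centres match again**: for an ideal sheaf `C'` on `Bl_{C_B} X_B` (the next B-centre),
`(C'·𝒪_{Bl X_O})·𝒪_{Bl X_k} = C'·𝒪_{Bl X_k}` along `j₂` — the hypothesis `hCD` of `Descent.modelStage` at the next stage of `CentreSeq.comap`.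
[folklore] [OURS · L1 W4.5b · D18 engine (E4)] -/
theorem Descent.comap_comapMap_comp_eq (j₂ : blowup (CB.comap ιk) ⟶ blowup (CB.comap ιO))
    (hj₂ : j₂ ≫ blowup.π (CB.comap ιO) = blowup.π (CB.comap ιk) ≫ j) (C' : (blowup CB).IdealSheafData) :
    (C'.comap (blowup.comapMap CB ιO)).comap j₂ = C'.comap (blowup.comapMap CB ιk) := by
  rw [← Scheme.IdealSheafData.comap_comp, Descent.comp_comapMap_eq ιO ιk j hj CB j₂ hj₂]

end Canonical

/-! ## (E5) the END transfer -/

section End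

/-- **(E5) END through the last model square**: for a closed immersion `j : F ⟶ X'` (the special fibre of the last stage) and `S' = j '' T`, the reduced
structure on `closure S' ⊆ X'` is regular iff the reduced structure on `closure T ⊆ F` is (✓ `isRegular_subscheme_vanishingIdeal_image_iff`; the closure
commutes with the closed embedding). [cite: StacksProject, Tag 01J3] [OURS · L1 W4.5b · D18 engine (E5)] -/
theorem Descent.isRegular_reducedTransform_of_model {X' F : Scheme.{0}} (j : F ⟶ X') [IsClosedImmersion j] (T : Set F) (S' : Set X')
    (hTS : j '' T = S')
    (hreg : Scheme.IsRegular (vanishingIdeal (⟨closure T, isClosed_closure⟩ : Closeds F)).subscheme) :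
    Scheme.IsRegular (vanishingIdeal (⟨closure S', isClosed_closure⟩ : Closeds X')).subscheme := by
  have hcl : j '' closure T = closure S' := by rw [← j.isClosedEmbedding.closure_image_eq, hTS]
  have hT : IsClosed (j '' ((⟨closure T, isClosed_closure⟩ : Closeds F) : Set F)) := by
    show IsClosed (j '' closure T)
    rw [hcl]; exact isClosed_closure
  have h := (isRegular_subscheme_vanishingIdeal_image_iff j ⟨closure T, isClosed_closure⟩ hT).mpr hreg
  have heq : (⟨j '' ((⟨closure T, isClosed_closure⟩ : Closeds F) : Set F), hT⟩ : Closeds X') = ⟨closure S', isClosed_closure⟩ :=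
    Closeds.ext hcl
  rw [heq] at h
  exact h

end End

end Summit.ResolutionOfSingularities.ResolutionOfSingularities.Cruxes.EquisingularLiftNat.Sections

end
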